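import Mathlib
import Summits.KontsevichZagierPeriods.KontsevichZagierPeriods.Theorems.SoloInformedLegendreSectorHalf
import Summits.KontsevichZagierPeriods.KontsevichZagierPeriods.Theorems.SoloInformedLegendreLanden
import Summits.KontsevichZagierPeriods.KontsevichZagierPeriods.Theorems.SoloInformedLegendreLandenSecond
import HarnessLib
import HarnessLib.Audit

/-!
# SoloInformed — Legendre relation XIV: the CM sector of discriminant `−8` (`k₂ = √2 − 1`)

Solo-informed residency (s33), file XIV of the Legendre chain.

At the singular modulus `k₂ = √2 − 1` (`μ = k₂² = 3 − 2√2`, CM by `ℤ[√−2]`) three theorems OF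
THE CALCULUS — Legendre's relation in `P` (THEOREM XVII), Landen of the first kind
(COROLLARY XIX.2: `⟦K'⟧ = ⟦[pt,√2]⟧⟦K⟧`) and Landen of the second kind (COROLLARY XX.2:
`⟦E'⟧ = ⟦[pt,√2]⟧⟦E⟧ − ⟦[pt,2−√2]⟧⟦K⟧`) — combine to

  `⟦π⟧ = 4·⟦[pt,√2]⟧·⟦E⟧·⟦K⟧ − 4·⟦K⟧²`   in `P`   (`soloInformed_piRep_eq_sqrtTwo`),

the period-ring form of `π = 4√2·E(k₂)K(k₂) − 4K(k₂)²`. Consequently the `K`-hull of the two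
classes `⟦K(k₂)⟧, ⟦E(k₂)⟧` contains `⟦π⟧, ⟦K'(k₂)⟧, ⟦E'(k₂)⟧`, and

THEOREM XXI (`soloInformed_kzp_on_hull_ellipticSqrtTwo`): if `K(k₂)` and `π` are algebraically
independent over `ℚ` (G. V. Chudnovsky's theorem for CM periods), the Kontsevich–Zagier period
conjecture holds on the hull `K[⟦K(k₂)⟧, ⟦E(k₂)⟧]` — the second decided CM elliptic sector, and
the first where `K' ≠ K`.

References: Legendre (1811); Landen (1775); Borwein–Borwein, *Pi and the AGM* (1987) Ch. 1–2, 5;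
G. V. Chudnovsky, *Contributions to the theory of transcendental numbers* (1984) Ch. 7;
this work (s33).
-/

noncomputable section

open MeasureTheory Set Filter
open scoped Classical

open Literature.NumberTheory.Transcendental Literature.NumberTheory.Transcendental.KZ
open Literature.ModelTheory.ExponentialFields

namespace Summit.KontsevichZagierPeriods.KontsevichZagierPeriods.Theorems

/-- **`⟦π⟧ = 4⟦[pt,√2]⟧⟦E⟧⟦K⟧ − 4⟦K⟧²` at `k₂ = √2 − 1`, in `P`.** Legendre's relation (XVII)
with the two Landen CM relations (XIX.2, XX.2) substituted. [this work] -/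
theorem soloInformed_piRep_eq_sqrtTwo (K E : IntegralRep 1)
    (hKd : K.domain = {x : Fin 1 → ℝ | x 0 ∈ Ioo (0:ℝ) 1})
    (hKi : EqOn K.integrand (fun x => (√(1 - x 0 ^ 2))⁻¹ *
      (√(1 - (√2 - 1) ^ 2 * x 0 ^ 2))⁻¹) K.domain)
    (hEd : E.domain = {x : Fin 1 → ℝ | x 0 ∈ Ioo (0:ℝ) 1})
    (hEi : EqOn E.integrand (fun x => (1 - (√2 - 1) ^ 2 * x 0 ^ 2) *
      ((√(1 - x 0 ^ 2))⁻¹ * (√(1 - (√2 - 1) ^ 2 * x 0 ^ 2))⁻¹)) E.domain)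
    (h2 : IsAlgebraic ℚ (√2 : ℝ)) :
    toFormalPeriod (of KZ.piRep) =
      4 * toFormalPeriod (of (IntegralRep.unit.constMul (√2) h2)) * toFormalPeriod (of E) *
        toFormalPeriod (of K) - 4 * toFormalPeriod (of K) * toFormalPeriod (of K) := by
  have hs2 : (√2 : ℝ) ^ 2 = 2 := Real.sq_sqrt (by norm_num)
  have hs2p : (1:ℝ) < √2 := by
    rw [show (1:ℝ) = √1 from Real.sqrt_one.symm]
    exact Real.sqrt_lt_sqrt (by norm_num) (by norm_num)
  have hs2l : (√2 : ℝ) < 2 := by nlinarith [Real.sqrt_nonneg 2]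
  have hμ : (√2 - 1) ^ 2 ∈ Ioo (0:ℝ) 1 := by
    constructor
    · exact pow_pos (by linarith) 2
    · nlinarith
  have hμa : IsAlgebraic ℚ ((√2 - 1) ^ 2 : ℝ) := (h2.sub isAlgebraic_one).pow 2
  have hμ' : 1 - (√2 - 1) ^ 2 ∈ Ioo (0:ℝ) 1 := ⟨by linarith [hμ.2], by linarith [hμ.1]⟩
  have hμ'a : IsAlgebraic ℚ (1 - (√2 - 1) ^ 2 : ℝ) := isAlgebraic_one.sub hμa
  have h22 : IsAlgebraic ℚ (2 - √2 : ℝ) := (isAlgebraic_nat (R := ℚ) (A := ℝ) 2).sub h2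
  obtain ⟨K', hK'd, hK'i⟩ := soloInformed_exists_ellipticK_rep _ hμ' hμ'a
  obtain ⟨E', hE'd, hE'i⟩ := soloInformed_exists_ellipticE_rep _ hμ' hμ'a
  have hleg := soloInformed_legendre_relation ((√2 - 1) ^ 2) hμ hμa K K' E E' hKd hKi hK'd
    (fun x _ => hK'i x) hEd hEi hE'd (fun x _ => hE'i x)
  have hK' := soloInformed_ellipticK_sqrtTwoSubOne_complementary K K' hKd hKi hK'd
    (fun x _ => hK'i x) h2
  have hE' := soloInformed_ellipticE_sqrtTwoSubOne_complementary K E E' hKd hKi hEd hEi hE'd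
    (fun x _ => hE'i x) h2 h22
  have hsum : toFormalPeriod (of (IntegralRep.unit.constMul (2 - √2) h22)) +
      toFormalPeriod (of (IntegralRep.unit.constMul (√2) h2)) = 2 := by
    have h2a : IsAlgebraic ℚ ((2 - √2) + √2 : ℝ) := by
      rw [sub_add_cancel]; exact isAlgebraic_nat (R := ℚ) (A := ℝ) 2
    have h11 : IsAlgebraic ℚ ((1 : ℝ) + 1) := isAlgebraic_one.add isAlgebraic_one
    have e : ((2 - √2) + √2 : ℝ) = 1 + 1 := by ring
    rw [soloInformed_pointRep_add (2 - √2) (√2) h22 h2 h2a, soloInformed_pointRep_congr h2a h11 e,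
      ← soloInformed_pointRep_add 1 1 isAlgebraic_one isAlgebraic_one h11, soloInformed_pointRep_one]
    norm_num
  rw [← hleg, hK', hE']
  linear_combination (-2 * toFormalPeriod (of K) * toFormalPeriod (of K)) * hsum

/-- The value form: `π = 4√2·E(k₂)·K(k₂) − 4K(k₂)²`, `k₂ = √2 − 1`. [classical; this work] -/
theorem soloInformed_pi_eq_sqrtTwo_value (K E : IntegralRep 1)
    (hKd : K.domain = {x : Fin 1 → ℝ | x 0 ∈ Ioo (0:ℝ) 1})
    (hKi : EqOn K.integrand (fun x => (√(1 - x 0 ^ 2))⁻¹ *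
      (√(1 - (√2 - 1) ^ 2 * x 0 ^ 2))⁻¹) K.domain)
    (hEd : E.domain = {x : Fin 1 → ℝ | x 0 ∈ Ioo (0:ℝ) 1})
    (hEi : EqOn E.integrand (fun x => (1 - (√2 - 1) ^ 2 * x 0 ^ 2) *
      ((√(1 - x 0 ^ 2))⁻¹ * (√(1 - (√2 - 1) ^ 2 * x 0 ^ 2))⁻¹)) E.domain) :
    Real.pi = 4 * √2 * E.value * K.value - 4 * K.value * K.value := by
  have h2 : IsAlgebraic ℚ (√2 : ℝ) := ⟨Polynomial.X ^ 2 - Polynomial.C 2,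
    (Polynomial.monic_X_pow_sub_C (2 : ℚ) two_ne_zero).ne_zero, by simp [Real.sq_sqrt]⟩
  have h := congrArg evalP (soloInformed_piRep_eq_sqrtTwo K E hKd hKi hEd hEi h2)
  simp only [map_mul, map_sub, map_ofNat, evalP_toFormalPeriod_of, KZ.piRep_value,
    IntegralRep.value_constMul, IntegralRep.value_unit, mul_one] at h
  rw [h]

/-- **`K(k₂), E(k₂)` are algebraically independent if `K(k₂), π` are** (`k₂ = √2 − 1`): transfer
through `π = 4K·(√2E) − 4K²` and `(√2E)² = 2E²`. [this work] -/
theorem soloInformed_algebraicIndependent_ellipticSqrtTwo (K E : IntegralRep 1)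
    (hKd : K.domain = {x : Fin 1 → ℝ | x 0 ∈ Ioo (0:ℝ) 1})
    (hKi : EqOn K.integrand (fun x => (√(1 - x 0 ^ 2))⁻¹ *
      (√(1 - (√2 - 1) ^ 2 * x 0 ^ 2))⁻¹) K.domain)
    (hEd : E.domain = {x : Fin 1 → ℝ | x 0 ∈ Ioo (0:ℝ) 1})
    (hEi : EqOn E.integrand (fun x => (1 - (√2 - 1) ^ 2 * x 0 ^ 2) *
      ((√(1 - x 0 ^ 2))⁻¹ * (√(1 - (√2 - 1) ^ 2 * x 0 ^ 2))⁻¹)) E.domain)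
    (hind : AlgebraicIndependent ℚ ![K.value, Real.pi]) :
    AlgebraicIndependent ℚ ![K.value, E.value] := by
  have hs2 : (√2 : ℝ) ^ 2 = 2 := Real.sq_sqrt (by norm_num)
  have hpi := soloInformed_pi_eq_sqrtTwo_value K E hKd hKi hEd hEi
  -- step 1: `(K, π) ↦ (K, √2·E)`
  have h1 : AlgebraicIndependent ℚ ![K.value, √2 * E.value] := by
    set F : IntermediateField ℚ ℝ := IntermediateField.adjoin ℚ ({K.value, √2 * E.value} : Set ℝ)
    have hKF : K.value ∈ F := IntermediateField.subset_adjoin ℚ _ (by simp)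
    have hEF : √2 * E.value ∈ F := IntermediateField.subset_adjoin ℚ _ (by simp)
    refine soloInformed_algebraicIndependent_pair_transfer hind ⟨1, one_pos, by rw [pow_one]; exact hKF⟩
      ⟨1, one_pos, ?_⟩
    rw [pow_one, hpi, show 4 * √2 * E.value * K.value - 4 * K.value * K.value =
      4 * K.value * (√2 * E.value) - 4 * K.value * K.value by ring]
    exact sub_mem (mul_mem (mul_mem (by exact_mod_cast F.natCast_mem 4) hKF) hEF)
      (mul_mem (mul_mem (by exact_mod_cast F.natCast_mem 4) hKF) hKF)
  -- step 2: `(K, √2·E) ↦ (K, E)`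
  set G : IntermediateField ℚ ℝ := IntermediateField.adjoin ℚ ({K.value, E.value} : Set ℝ)
  have hKG : K.value ∈ G := IntermediateField.subset_adjoin ℚ _ (by simp)
  have hEG : E.value ∈ G := IntermediateField.subset_adjoin ℚ _ (by simp)
  refine soloInformed_algebraicIndependent_pair_transfer h1 ⟨1, one_pos, by rw [pow_one]; exact hKG⟩
    ⟨2, two_pos, ?_⟩
  rw [mul_pow, hs2]
  exact mul_mem (by exact_mod_cast G.natCast_mem 2) (pow_mem hEG 2)

/-! ### THEOREM XXI: the `K`-hull of `⟦K(√2−1)⟧, ⟦E(√2−1)⟧` is decided (given Chudnovsky) -/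

/-- **THEOREM XXI (decided CM elliptic sector of discriminant `−8`).** If `K(√2−1)` and `π` are
algebraically independent over `ℚ` (Chudnovsky 1984, Ch. 7, for CM elliptic curves), the
Kontsevich–Zagier period conjecture holds on the `K`-hull `K[⟦K(√2−1)⟧, ⟦E(√2−1)⟧] ⊂ P`:
representations (any dimensions) with classes in the hull and equal values are equivalent under
the three rules. Inputs of the calculus: THEOREM XVII, COROLLARIES XIX.2 and XX.2. [this work] -/
theorem soloInformed_kzp_on_hull_ellipticSqrtTwo (K E : IntegralRep 1)
    (hKd : K.domain = {x : Fin 1 → ℝ | x 0 ∈ Ioo (0:ℝ) 1})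
    (hKi : EqOn K.integrand (fun x => (√(1 - x 0 ^ 2))⁻¹ *
      (√(1 - (√2 - 1) ^ 2 * x 0 ^ 2))⁻¹) K.domain)
    (hEd : E.domain = {x : Fin 1 → ℝ | x 0 ∈ Ioo (0:ℝ) 1})
    (hEi : EqOn E.integrand (fun x => (1 - (√2 - 1) ^ 2 * x 0 ^ 2) *
      ((√(1 - x 0 ^ 2))⁻¹ * (√(1 - (√2 - 1) ^ 2 * x 0 ^ 2))⁻¹)) E.domain)
    (hind : AlgebraicIndependent ℚ ![K.value, Real.pi])
    {n m : ℕ} (r : IntegralRep n) (r' : IntegralRep m)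
    (hr : toFormalPeriod (of r) ∈
      soloInformedAlgHull ![toFormalPeriod (of K), toFormalPeriod (of E)])
    (hr' : toFormalPeriod (of r') ∈
      soloInformedAlgHull ![toFormalPeriod (of K), toFormalPeriod (of E)])
    (hv : r.value = r'.value) : Equivalent r r' := by
  refine soloInformed_kzp_on_algHull _ (soloInformed_algebraicIndependent_evalP_pair ?_)
    r r' hr hr' hv
  rw [evalP_toFormalPeriod_of, evalP_toFormalPeriod_of]
  exact soloInformed_algebraicIndependent_ellipticSqrtTwo K E hKd hKi hEd hEi hind

/-- **Equality in `P` is decided by values on the hull** `K[⟦K(√2−1)⟧, ⟦E(√2−1)⟧]` (given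
Chudnovsky). [this work] -/
theorem soloInformed_eq_of_value_eq_on_hull_ellipticSqrtTwo (K E : IntegralRep 1)
    (hKd : K.domain = {x : Fin 1 → ℝ | x 0 ∈ Ioo (0:ℝ) 1})
    (hKi : EqOn K.integrand (fun x => (√(1 - x 0 ^ 2))⁻¹ *
      (√(1 - (√2 - 1) ^ 2 * x 0 ^ 2))⁻¹) K.domain)
    (hEd : E.domain = {x : Fin 1 → ℝ | x 0 ∈ Ioo (0:ℝ) 1})
    (hEi : EqOn E.integrand (fun x => (1 - (√2 - 1) ^ 2 * x 0 ^ 2) *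
      ((√(1 - x 0 ^ 2))⁻¹ * (√(1 - (√2 - 1) ^ 2 * x 0 ^ 2))⁻¹)) E.domain)
    (hind : AlgebraicIndependent ℚ ![K.value, Real.pi])
    {x y : FormalPeriodRing}
    (hx : x ∈ soloInformedAlgHull ![toFormalPeriod (of K), toFormalPeriod (of E)])
    (hy : y ∈ soloInformedAlgHull ![toFormalPeriod (of K), toFormalPeriod (of E)])
    (h : evalP x = evalP y) : x = y := by
  refine soloInformed_eq_of_evalP_eq_of_mem_algHull _
    (soloInformed_algebraicIndependent_evalP_pair ?_) hx hy h
  rw [evalP_toFormalPeriod_of, evalP_toFormalPeriod_of]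
  exact soloInformed_algebraicIndependent_ellipticSqrtTwo K E hKd hKi hEd hEi hind

/-! ### What the hull contains: `⟦π⟧`, `⟦K'(√2−1)⟧`, `⟦E'(√2−1)⟧` -/

/-- `⟦π⟧ ∈ K[⟦K(√2−1)⟧, ⟦E(√2−1)⟧]`. [this work] -/
theorem soloInformed_piRep_mem_hull_ellipticSqrtTwo (K E : IntegralRep 1)
    (hKd : K.domain = {x : Fin 1 → ℝ | x 0 ∈ Ioo (0:ℝ) 1})
    (hKi : EqOn K.integrand (fun x => (√(1 - x 0 ^ 2))⁻¹ *
      (√(1 - (√2 - 1) ^ 2 * x 0 ^ 2))⁻¹) K.domain)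
    (hEd : E.domain = {x : Fin 1 → ℝ | x 0 ∈ Ioo (0:ℝ) 1})
    (hEi : EqOn E.integrand (fun x => (1 - (√2 - 1) ^ 2 * x 0 ^ 2) *
      ((√(1 - x 0 ^ 2))⁻¹ * (√(1 - (√2 - 1) ^ 2 * x 0 ^ 2))⁻¹)) E.domain) :
    toFormalPeriod (of KZ.piRep) ∈
      soloInformedAlgHull ![toFormalPeriod (of K), toFormalPeriod (of E)] := by
  have h2 : IsAlgebraic ℚ (√2 : ℝ) := ⟨Polynomial.X ^ 2 - Polynomial.C 2,
    (Polynomial.monic_X_pow_sub_C (2 : ℚ) two_ne_zero).ne_zero, by simp [Real.sq_sqrt]⟩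
  rw [soloInformed_piRep_eq_sqrtTwo K E hKd hKi hEd hEi h2]
  have hK := soloInformed_mem_algHull_self ![toFormalPeriod (of K), toFormalPeriod (of E)] 0
  have hE := soloInformed_mem_algHull_self ![toFormalPeriod (of K), toFormalPeriod (of E)] 1
  simp only [Matrix.cons_val_zero, Matrix.cons_val_one] at hK hE
  have hp := soloInformed_pointRep_mem_algHull ![toFormalPeriod (of K), toFormalPeriod (of E)] (√2) h2
  exact sub_mem (mul_mem (mul_mem (mul_mem (ofNat_mem _ 4) hp) hE) hK)
    (mul_mem (mul_mem (ofNat_mem _ 4) hK) hK)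

/-- `⟦K'(√2−1)⟧ ∈ K[⟦K(√2−1)⟧, ⟦E(√2−1)⟧]` for every Legendre representation `K'` of the
complementary modulus — by COROLLARY XIX.2. [this work] -/
theorem soloInformed_ellipticK'_mem_hull_ellipticSqrtTwo (K E K' : IntegralRep 1)
    (hKd : K.domain = {x : Fin 1 → ℝ | x 0 ∈ Ioo (0:ℝ) 1})
    (hKi : EqOn K.integrand (fun x => (√(1 - x 0 ^ 2))⁻¹ *
      (√(1 - (√2 - 1) ^ 2 * x 0 ^ 2))⁻¹) K.domain)
    (hK'd : K'.domain = {x : Fin 1 → ℝ | x 0 ∈ Ioo (0:ℝ) 1})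
    (hK'i : EqOn K'.integrand
      (fun x => (√(1 - x 0 ^ 2))⁻¹ * (√(1 - (1 - (√2 - 1) ^ 2) * x 0 ^ 2))⁻¹) K'.domain) :
    toFormalPeriod (of K') ∈
      soloInformedAlgHull ![toFormalPeriod (of K), toFormalPeriod (of E)] := by
  have h2 : IsAlgebraic ℚ (√2 : ℝ) := ⟨Polynomial.X ^ 2 - Polynomial.C 2,
    (Polynomial.monic_X_pow_sub_C (2 : ℚ) two_ne_zero).ne_zero, by simp [Real.sq_sqrt]⟩
  rw [soloInformed_ellipticK_sqrtTwoSubOne_complementary K K' hKd hKi hK'd hK'i h2]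
  have hK := soloInformed_mem_algHull_self ![toFormalPeriod (of K), toFormalPeriod (of E)] 0
  simp only [Matrix.cons_val_zero] at hK
  exact mul_mem (soloInformed_pointRep_mem_algHull _ (√2) h2) hK

/-- `⟦E'(√2−1)⟧ ∈ K[⟦K(√2−1)⟧, ⟦E(√2−1)⟧]` for every Legendre representation `E'` of the
complementary modulus — by COROLLARY XX.2. [this work] -/
theorem soloInformed_ellipticE'_mem_hull_ellipticSqrtTwo (K E E' : IntegralRep 1)
    (hKd : K.domain = {x : Fin 1 → ℝ | x 0 ∈ Ioo (0:ℝ) 1})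
    (hKi : EqOn K.integrand (fun x => (√(1 - x 0 ^ 2))⁻¹ *
      (√(1 - (√2 - 1) ^ 2 * x 0 ^ 2))⁻¹) K.domain)
    (hEd : E.domain = {x : Fin 1 → ℝ | x 0 ∈ Ioo (0:ℝ) 1})
    (hEi : EqOn E.integrand (fun x => (1 - (√2 - 1) ^ 2 * x 0 ^ 2) *
      ((√(1 - x 0 ^ 2))⁻¹ * (√(1 - (√2 - 1) ^ 2 * x 0 ^ 2))⁻¹)) E.domain)
    (hE'd : E'.domain = {x : Fin 1 → ℝ | x 0 ∈ Ioo (0:ℝ) 1})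
    (hE'i : EqOn E'.integrand (fun x => (1 - (1 - (√2 - 1) ^ 2) * x 0 ^ 2) *
      ((√(1 - x 0 ^ 2))⁻¹ * (√(1 - (1 - (√2 - 1) ^ 2) * x 0 ^ 2))⁻¹)) E'.domain) :
    toFormalPeriod (of E') ∈
      soloInformedAlgHull ![toFormalPeriod (of K), toFormalPeriod (of E)] := by
  have h2 : IsAlgebraic ℚ (√2 : ℝ) := ⟨Polynomial.X ^ 2 - Polynomial.C 2,
    (Polynomial.monic_X_pow_sub_C (2 : ℚ) two_ne_zero).ne_zero, by simp [Real.sq_sqrt]⟩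
  have h22 : IsAlgebraic ℚ (2 - √2 : ℝ) := (isAlgebraic_nat (R := ℚ) (A := ℝ) 2).sub h2
  rw [soloInformed_ellipticE_sqrtTwoSubOne_complementary K E E' hKd hKi hEd hEi hE'd hE'i h2 h22]
  have hK := soloInformed_mem_algHull_self ![toFormalPeriod (of K), toFormalPeriod (of E)] 0
  have hE := soloInformed_mem_algHull_self ![toFormalPeriod (of K), toFormalPeriod (of E)] 1
  simp only [Matrix.cons_val_zero, Matrix.cons_val_one] at hK hE
  exact sub_mem (mul_mem (soloInformed_pointRep_mem_algHull _ (√2) h2) hE)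
    (mul_mem (soloInformed_pointRep_mem_algHull _ (2 - √2) h22) hK)

/-- **THEOREM XXI with the representations discharged**: Legendre representations `K(√2−1)`,
`E(√2−1)` on `(0,1)` exist, and on their hull KZP holds as soon as `K(√2−1)` and `π` are
algebraically independent. [this work] -/
theorem soloInformed_kzp_on_hull_ellipticSqrtTwo_exists :
    ∃ K E : IntegralRep 1, K.domain = {x : Fin 1 → ℝ | x 0 ∈ Ioo (0:ℝ) 1} ∧
      (∀ x, K.integrand x = (√(1 - x 0 ^ 2))⁻¹ * (√(1 - (√2 - 1) ^ 2 * x 0 ^ 2))⁻¹) ∧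
      E.domain = {x : Fin 1 → ℝ | x 0 ∈ Ioo (0:ℝ) 1} ∧
      (∀ x, E.integrand x = (1 - (√2 - 1) ^ 2 * x 0 ^ 2) *
        ((√(1 - x 0 ^ 2))⁻¹ * (√(1 - (√2 - 1) ^ 2 * x 0 ^ 2))⁻¹)) ∧
      toFormalPeriod (of KZ.piRep) ∈
        soloInformedAlgHull ![toFormalPeriod (of K), toFormalPeriod (of E)] ∧
      (AlgebraicIndependent ℚ ![K.value, Real.pi] →
        ∀ {n m : ℕ} (r : IntegralRep n) (r' : IntegralRep m),
          toFormalPeriod (of r) ∈ soloInformedAlgHull ![toFormalPeriod (of K), toFormalPeriod (of E)] →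
          toFormalPeriod (of r') ∈ soloInformedAlgHull ![toFormalPeriod (of K), toFormalPeriod (of E)] →
          r.value = r'.value → Equivalent r r') := by
  have hs2p : (1:ℝ) < √2 := by
    rw [show (1:ℝ) = √1 from Real.sqrt_one.symm]
    exact Real.sqrt_lt_sqrt (by norm_num) (by norm_num)
  have hs2l : (√2 : ℝ) < 2 := by nlinarith [Real.sqrt_nonneg 2, Real.sq_sqrt (show (0:ℝ) ≤ 2 by norm_num)]
  have hμ : (√2 - 1) ^ 2 ∈ Ioo (0:ℝ) 1 := ⟨pow_pos (by linarith) 2, by nlinarith⟩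
  have h2 : IsAlgebraic ℚ (√2 : ℝ) := ⟨Polynomial.X ^ 2 - Polynomial.C 2,
    (Polynomial.monic_X_pow_sub_C (2 : ℚ) two_ne_zero).ne_zero, by simp [Real.sq_sqrt]⟩
  have hμa : IsAlgebraic ℚ ((√2 - 1) ^ 2 : ℝ) := (h2.sub isAlgebraic_one).pow 2
  obtain ⟨K, hKd, hKi⟩ := soloInformed_exists_ellipticK_rep _ hμ hμa
  obtain ⟨E, hEd, hEi⟩ := soloInformed_exists_ellipticE_rep _ hμ hμa
  exact ⟨K, E, hKd, hKi, hEd, hEi,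
    soloInformed_piRep_mem_hull_ellipticSqrtTwo K E hKd (fun x _ => hKi x) hEd (fun x _ => hEi x),
    fun hind _ _ r r' hr hr' hv => soloInformed_kzp_on_hull_ellipticSqrtTwo K E hKd
      (fun x _ => hKi x) hEd (fun x _ => hEi x) hind r r' hr hr' hv⟩

end Summit.KontsevichZagierPeriods.KontsevichZagierPeriods.Theorems

end
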